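import Summits.BirchSwinnertonDyer.BirchSwinnertonDyer.Theorems.ManinLocalTwoThreeKummerCubeRootHolomorphicExtension
import Literature.NumberTheory.EllipticCurves.EichlerIntegralPolesProofs
import HarnessLib

/-!
# (AN2-e) The σ-Kummer witness is BOUNDED at every cusp
(route `ManinLocalTwoThree`, crux C3 `ManinPrimeToThreeAtNine` stmt-BirchSwinnertonDyer-22968 — and verbatim for C2's `ℓ = 2` twin; cell bsd-f2-manin,
p2 gen 17; `--supports stmt-BirchSwinnertonDyer-22968`; the growth clause `∀ g ∈ SL(2,ℤ), ‖(F ∣[k] g) τ‖ ≤ C·e^{m·Im τ}` of C3 v23's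
`stub_kummerCubeRootModularFormWitness`, here with `m = 0`)

Sequel to `…KummerCubeRootHolomorphicExtension` (AN2-d).  Let `F` be the extension of `B′·X(w)/σ(w)` (`w = c·E_f`), i.e. any function with the two
properties exported there (`F = B′·X(w)/σ(w)` off `φ⁻¹(O)`, `F = B·t_s·X(w)/σ(w)` where moreover `℘′(w) ≠ 0`, `B₀ ≠ 0`).  If `B ∣[k] g` and
`B′ ∣[k] g` are bounded at `i∞` for every `g ∈ SL(2, ℤ)` (e.g. `B, B′` holomorphic modular forms, Mathlib `ModularFormClass.bdd_at_infty_slash`) and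
`B₀(g·τ) ≠ 0` high in every cusp (e.g. `B₀` a non-zero cusp form, tree `exists_forall_apply_smul_ne_zero`), then **`F ∣[k] g` is bounded at `i∞` for
every `g`** (`exists_forall_norm_slash_le`).  Proof: near the cusp `g∞`, `E_f(gτ) = C_g + V_g(τ)` with `V_g → 0` (tree `exists_eichlerIntegral_smul_eq`,
`IsCuspFunction.exists_forall_norm_verticalIntegral_le`) and `w ∉ Λ` (tree `exists_forall_eichlerIntegral_smul_notMem`); if `c·C_g ∉ Λ` the factor
`X/σ` is continuous at `c·C_g` (chart 1), and if `c·C_g ∈ Λ` — the cusp maps to `O` — then `P₃(c·C_g) ≠ 0` and `F = B·Φ(w)` with `Φ` continuous at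
`c·C_g` (chart 2, AN2-d's `exists_sigmaKummer_package`).  NO Eichler integral at other cusps beyond the tree's, no `q_N`-orders, no rates.
Also: `newform_ne_zero` (`D.f ≠ 0`, from `a₁ = 1`).
HONEST FRAMING.  Kernel step; the rational pole-killer `B` (S69) and integrality (AN2-f) remain.  BSD is not proved by this; Manin's conjecture is
not proved; C2 and C3 remain OPEN.
[folklore]
-/

set_option autoImplicit false
-- lint-debt: the directory name repeats the summit name (sibling precedent `ManinLocalTwoThreeKummerCubeRootSigmaPrelims.lean`)
set_option linter.dupNamespace false

noncomputable section

open scoped Topology PeriodPair MatrixGroups Manifold ModularForm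
open Complex Filter
open UpperHalfPlane hiding I
open Literature.NumberTheory.EllipticCurves Literature.NumberTheory.EllipticCurves.ModularForms
open Summit.BirchSwinnertonDyer.Rank1Residual.ManinAdditive.KummerCubeMonodromy

namespace Summit.BirchSwinnertonDyer.BirchSwinnertonDyer.Theorems.ManinLocalTwoThree.KummerCubeRootDictionary

variable {W : WeierstrassCurve ℚ} {N : ℕ} [NeZero N]

/-- The newform of a parametrisation datum is non-zero (`a₁(f) = a₁(W) = 1`). [folklore] -/
theorem newform_ne_zero [W.IsElliptic] (D : ModularParametrizationData W N) : D.f ≠ 0 := by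
  have h1 : cuspCoeff D.f 1 = 1 := by
    rw [D.isNewformOf.2 1, W.isMultiplicative_LFunction.map_one]; simp
  intro h0
  rw [h0, cuspCoeff, CuspForm.coe_zero, qExpansion_zero, map_zero] at h1
  exact zero_ne_one h1

/-- `‖a‖ ≤ ‖b‖ + 1` when `dist a b < 1`. [folklore] -/
theorem norm_le_norm_add_one_of_dist_lt {a b : ℂ} (h : dist a b < 1) : ‖a‖ ≤ ‖b‖ + 1 := by
  rw [dist_eq_norm] at h
  linarith [norm_sub_norm_le a b]

/-- `‖P·D‖ ≤ M` and `‖Q‖ ≤ K` give `‖P·Q·D‖ ≤ M·K`. [folklore] -/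
theorem norm_mul_mul_le {P Q D : ℂ} {M K : ℝ} (hPD : ‖P * D‖ ≤ M) (hQ : ‖Q‖ ≤ K) : ‖P * Q * D‖ ≤ M * K := by
  rw [show P * Q * D = P * D * Q by ring, norm_mul]
  exact mul_le_mul hPD hQ (norm_nonneg _) ((norm_nonneg _).trans hPD)

/-- **(AN2-e) `F ∣[k] g` is bounded at `i∞` for every `g ∈ SL(2, ℤ)`.**  See the file header. [folklore] -/
theorem exists_forall_norm_slash_le (D : ModularParametrizationData W N) (hc0 : D.c ≠ 0) (hf : D.f ≠ 0)
    {X : ℂ → ℂ} (hX : Differentiable ℂ X) {k : ℤ} {B₀ B B' F : ℍ → ℂ}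
    (hB₀inf : ∀ g : SL(2, ℤ), ∃ T : ℝ, ∀ τ : ℍ, T ≤ τ.im → B₀ (g • τ) ≠ 0)
    (hBbd : ∀ g : SL(2, ℤ), IsBoundedAtImInfty (B ∣[k] g)) (hB'bd : ∀ g : SL(2, ℤ), IsBoundedAtImInfty (B' ∣[k] g))
    (hF1 : ∀ τ : ℍ, (D.c : ℂ) * eichlerIntegral D.f τ ∉ D.L.lattice →
      F τ = B' τ * (X ((D.c : ℂ) * eichlerIntegral D.f τ) / D.L.weierstrassSigma ((D.c : ℂ) * eichlerIntegral D.f τ)))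
    (hF2 : ∀ τ : ℍ, (D.c : ℂ) * eichlerIntegral D.f τ ∉ D.L.lattice → ℘'[D.L] ((D.c : ℂ) * eichlerIntegral D.f τ) ≠ 0 → B₀ τ ≠ 0 →
      F τ = B τ * (shortT D τ *
        (X ((D.c : ℂ) * eichlerIntegral D.f τ) / D.L.weierstrassSigma ((D.c : ℂ) * eichlerIntegral D.f τ))))
    (g : SL(2, ℤ)) : ∃ C A : ℝ, ∀ τ : ℍ, A ≤ τ.im → ‖(F ∣[k] g) τ‖ ≤ C := by
  obtain ⟨P₃, Φ, hP₃d, hP₃Λ, h℘ne, -, hΦd, hΦeq⟩ := exists_sigmaKummer_package D hc0 hX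
  have hc : (D.c : ℂ) ≠ 0 := Int.cast_ne_zero.mpr hc0
  have hcpos : 0 < ‖(D.c : ℂ)‖ + 1 := by positivity
  have hσd : Differentiable ℂ D.L.weierstrassSigma := D.L.differentiable_weierstrassSigma_holds
  have hσne : ∀ w, w ∉ D.L.lattice → D.L.weierstrassSigma w ≠ 0 := fun w hw h =>
    hw ((D.L.weierstrassSigma_eq_zero_iff_holds w).mp h)
  -- the Eichler integral near the cusp `g∞`
  obtain ⟨Cg, hCg⟩ := exists_eichlerIntegral_smul_eq D.f g
  have hφ := isCuspFunction_slash (k := 2) D.f g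
  obtain ⟨T₁, hT₁⟩ :=
    exists_forall_eichlerIntegral_smul_notMem D.f hf (D.L.mulLeft ((D.c : ℂ)⁻¹) (inv_ne_zero hc)) g
  have hT₁' : ∀ τ : ℍ, T₁ ≤ τ.im → (D.c : ℂ) * eichlerIntegral D.f (g • τ) ∉ D.L.lattice := by
    intro τ hτ h
    apply hT₁ τ hτ
    rw [PeriodPair.mem_mulLeft_lattice, inv_inv]
    exact h
  obtain ⟨MB, AB, hMB⟩ := UpperHalfPlane.isBoundedAtImInfty_iff.mp (hBbd g)
  obtain ⟨MB', AB', hMB'⟩ := UpperHalfPlane.isBoundedAtImInfty_iff.mp (hB'bd g)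
  obtain ⟨T₂, hT₂⟩ := hB₀inf g
  -- `w(g·τ) = w∞ + c·V_g(τ)`
  have hwτ : ∀ τ : ℍ, (D.c : ℂ) * eichlerIntegral D.f (g • τ) =
      (D.c : ℂ) * Cg + (D.c : ℂ) * verticalIntegral (⇑D.f ∣[(2 : ℤ)] g) τ := by
    intro τ; rw [hCg τ, mul_add]
  -- uniform approach to `w∞`
  have happroach : ∀ δ : ℝ, 0 < δ → ∃ M : ℝ, ∀ τ : ℍ, M ≤ τ.im →
      dist ((D.c : ℂ) * eichlerIntegral D.f (g • τ)) ((D.c : ℂ) * Cg) < δ := by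
    intro δ hδ
    obtain ⟨M, hM⟩ := hφ.exists_forall_norm_verticalIntegral_le (ε := δ / (‖(D.c : ℂ)‖ + 1)) (by positivity)
    refine ⟨M, fun τ hτ => ?_⟩
    rw [dist_eq_norm, hwτ τ, add_sub_cancel_left, norm_mul]
    calc ‖(D.c : ℂ)‖ * ‖verticalIntegral (⇑D.f ∣[(2 : ℤ)] g) τ‖
        ≤ ‖(D.c : ℂ)‖ * (δ / (‖(D.c : ℂ)‖ + 1)) := mul_le_mul_of_nonneg_left (hM τ hτ) (norm_nonneg _)
      _ < δ := by
          rw [mul_div_assoc', div_lt_iff₀ hcpos]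
          nlinarith [norm_nonneg (D.c : ℂ)]
  by_cases hΛ : (D.c : ℂ) * Cg ∈ D.L.lattice
  · -- the cusp `g∞` maps to `O`: chart 2
    have hP : P₃ ((D.c : ℂ) * Cg) ≠ 0 := hP₃Λ _ hΛ
    obtain ⟨δ₁, hδ₁, hΦball⟩ := Metric.continuousAt_iff.mp (hΦd _ hP).continuousAt 1 one_pos
    obtain ⟨δ₂, hδ₂, hPball⟩ := Metric.eventually_nhds_iff.mp ((hP₃d _).continuousAt.eventually_ne hP)
    obtain ⟨M₃, hM₃⟩ := happroach (min δ₁ δ₂) (lt_min hδ₁ hδ₂)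
    refine ⟨MB * (‖Φ ((D.c : ℂ) * Cg)‖ + 1), max (max T₁ T₂) (max AB M₃), fun τ hτ => ?_⟩
    have h12 : max T₁ T₂ ≤ τ.im := (le_max_left _ _).trans hτ
    have h1 : T₁ ≤ τ.im := (le_max_left _ _).trans h12
    have h2 : T₂ ≤ τ.im := (le_max_right _ _).trans h12
    have hA : AB ≤ τ.im := ((le_max_left _ _).trans ((le_max_right _ _).trans hτ))
    have h3 : M₃ ≤ τ.im := ((le_max_right _ _).trans ((le_max_right _ _).trans hτ))
    have hdist := hM₃ τ h3
    have hnotin := hT₁' τ h1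
    have hP₃w : P₃ ((D.c : ℂ) * eichlerIntegral D.f (g • τ)) ≠ 0 := hPball (lt_of_lt_of_le hdist (min_le_right _ _))
    have h℘ := h℘ne _ hnotin hP₃w
    have hFval : F (g • τ) = B (g • τ) * Φ ((D.c : ℂ) * eichlerIntegral D.f (g • τ)) := by
      rw [hF2 (g • τ) hnotin h℘ (hT₂ τ h2), hΦeq (g • τ) hnotin hP₃w]
    have hΦbd : ‖Φ ((D.c : ℂ) * eichlerIntegral D.f (g • τ))‖ ≤ ‖Φ ((D.c : ℂ) * Cg)‖ + 1 :=
      norm_le_norm_add_one_of_dist_lt (hΦball (lt_of_lt_of_le hdist (min_le_left _ _)))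
    have hBg := hMB τ hA
    rw [ModularForm.SL_slash_apply] at hBg
    rw [ModularForm.SL_slash_apply, hFval]
    exact norm_mul_mul_le hBg hΦbd
  · -- the cusp `g∞` maps to a point `≠ O`: chart 1
    have hσ0 : D.L.weierstrassSigma ((D.c : ℂ) * Cg) ≠ 0 := hσne _ hΛ
    have hVc : ContinuousAt (fun w => X w / D.L.weierstrassSigma w) ((D.c : ℂ) * Cg) :=
      ((hX _).div (hσd _) hσ0).continuousAt
    obtain ⟨δ₁, hδ₁, hVball⟩ := Metric.continuousAt_iff.mp hVc 1 one_pos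
    obtain ⟨M₃, hM₃⟩ := happroach δ₁ hδ₁
    refine ⟨MB' * (‖X ((D.c : ℂ) * Cg) / D.L.weierstrassSigma ((D.c : ℂ) * Cg)‖ + 1), max T₁ (max AB' M₃), fun τ hτ => ?_⟩
    have h1 : T₁ ≤ τ.im := (le_max_left _ _).trans hτ
    have hA : AB' ≤ τ.im := ((le_max_left _ _).trans ((le_max_right _ _).trans hτ))
    have h3 : M₃ ≤ τ.im := ((le_max_right _ _).trans ((le_max_right _ _).trans hτ))
    have hdist := hM₃ τ h3
    have hnotin := hT₁' τ h1
    have hFval := hF1 (g • τ) hnotin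
    have hVbd : ‖X ((D.c : ℂ) * eichlerIntegral D.f (g • τ)) / D.L.weierstrassSigma ((D.c : ℂ) * eichlerIntegral D.f (g • τ))‖ ≤
        ‖X ((D.c : ℂ) * Cg) / D.L.weierstrassSigma ((D.c : ℂ) * Cg)‖ + 1 :=
      norm_le_norm_add_one_of_dist_lt (hVball hdist)
    have hBg := hMB' τ hA
    rw [ModularForm.SL_slash_apply] at hBg
    rw [ModularForm.SL_slash_apply, hFval]
    exact norm_mul_mul_le hBg hVbd

/-- **(AN2-e) in the shape of the witness law's growth clause** (`m = 0`). [folklore] -/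
theorem exists_growth_slash (D : ModularParametrizationData W N) (hc0 : D.c ≠ 0) (hf : D.f ≠ 0)
    {X : ℂ → ℂ} (hX : Differentiable ℂ X) {k : ℤ} {B₀ B B' F : ℍ → ℂ}
    (hB₀inf : ∀ g : SL(2, ℤ), ∃ T : ℝ, ∀ τ : ℍ, T ≤ τ.im → B₀ (g • τ) ≠ 0)
    (hBbd : ∀ g : SL(2, ℤ), IsBoundedAtImInfty (B ∣[k] g)) (hB'bd : ∀ g : SL(2, ℤ), IsBoundedAtImInfty (B' ∣[k] g))
    (hF1 : ∀ τ : ℍ, (D.c : ℂ) * eichlerIntegral D.f τ ∉ D.L.lattice →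
      F τ = B' τ * (X ((D.c : ℂ) * eichlerIntegral D.f τ) / D.L.weierstrassSigma ((D.c : ℂ) * eichlerIntegral D.f τ)))
    (hF2 : ∀ τ : ℍ, (D.c : ℂ) * eichlerIntegral D.f τ ∉ D.L.lattice → ℘'[D.L] ((D.c : ℂ) * eichlerIntegral D.f τ) ≠ 0 → B₀ τ ≠ 0 →
      F τ = B τ * (shortT D τ *
        (X ((D.c : ℂ) * eichlerIntegral D.f τ) / D.L.weierstrassSigma ((D.c : ℂ) * eichlerIntegral D.f τ)))) :
    ∀ g : SL(2, ℤ), ∃ C A m : ℝ, ∀ τ : ℍ, A ≤ τ.im → ‖(F ∣[k] g) τ‖ ≤ C * Real.exp (m * τ.im) := by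
  intro g
  obtain ⟨C, A, h⟩ := exists_forall_norm_slash_le D hc0 hf hX hB₀inf hBbd hB'bd hF1 hF2 g
  exact ⟨C, A, 0, fun τ hτ => by simpa using h τ hτ⟩

end Summit.BirchSwinnertonDyer.BirchSwinnertonDyer.Theorems.ManinLocalTwoThree.KummerCubeRootDictionary

end
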